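import Summits.BirchSwinnertonDyer.Rank1Residual.X11b.LocalPrimaryFinite
import Literature.NumberTheory.EllipticCurves.KummerSequenceConnecting
import Literature.NumberTheory.EllipticCurves.KummerSelmerStructure
import Literature.NumberTheory.GaloisRepresentations.ContinuousCohomologyConnecting
import HarnessLib

/-!
# X11b, route R1 — towards (L10): the transition maps `H²(K_v, E[p^a]) → H²(K_v, E[p^{a+b}])`
# VANISH for large levels at a finite place `v ∤ p` (so `H²(K_v, E[p^∞]) = lim→ = 0`)

HONEST FRAMING (cell `b2b-bsdres`; verbatim framing in `LevelLiftingFromFiniteness.lean`): research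
route R1 on X11b; X11b stays CONSTRUCTION-SHAPED; no label change; nothing booked; no named fact
minted (theorems only; no `sorry`); the local-field theorems are CONDITIONAL on the cited
`localEulerPoincareCharacteristic (K_v)` (Milne I 2.8, hypothesis `hEP`).

## What is here (JSW17 §2.2.2 / proof of Lemma 3.3.3: "`H²(K_w, W)` is dual to `H⁰(K_w, T) = 0`")

A COUNTING proof (no functorial local duality) that the transition maps of the direct system
`(H²(K_v, E[p^k]))_k` vanish at large levels: `IsSES.map_two_eq_zero_of_card` (for
`0 → M₁ → M₂ → M₃ → 0` with `#H¹(Mᵢ) = h²`, `#M₃^Γ = h = #H²(M₁)` and `M₂ → M₃` killing `M₂^Γ`,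
`δ₁ : H¹(M₃) → H²(M₁)` is ONTO along the tree's long exact sequence, so `H²(M₁) → H²(M₂)` is ZERO);
uniform exponents of the rational / fixed geometric `p`-power torsion at `v ∤ p`
(`exists_pow_nsmul_rational_eq_zero`, `exists_pow_nsmul_fixed_eq_zero`, from `LocalPrimaryFinite`);
**`map_two_torsionInclusion_eq_zero`**, **`exists_forall_map_two_torsionInclusion_eq_zero`**:
`H²(K_v, E[p^a]) → H²(K_v, E[p^a·p^b])` vanishes for `a, b` large (counts from the cited Milne I 2.8
and the tree's `LocalEulerCharacteristicTorsion`).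

References: [JetchevSkinnerWan2017] §2.2.2, Lemma 3.3.3; [MilneADT2006] I Thm. 2.8, Cor. 2.3;
[GreenbergLNM1716] §3; [SerreGaloisCohomology1997] I §2.2 (long exact sequence).
-/

noncomputable section

open scoped Classical

open CategoryTheory Field NumberField IsDedekindDomain
open Literature.NumberTheory.EllipticCurves
open Literature.NumberTheory.GaloisRepresentations
open scoped ContRepresentation

universe u

namespace Summit.BirchSwinnertonDyer.Rank1Residual.X11b.Levels

/-! ## §1. Counting along the long exact sequence -/

section Counting

-- `δ₁`, `H²` need `LocallyCompactSpace Γ_F`; compactness of absolute Galois groups, locally.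
attribute [local instance] absoluteGaloisGroup_compactSpace

variable {F : Type u} [Field F] {M₁ M₂ M₃ : Type u}
  [AddCommGroup M₁] [TopologicalSpace M₁] [DiscreteTopology M₁]
  [AddCommGroup M₂] [TopologicalSpace M₂] [DiscreteTopology M₂]
  [AddCommGroup M₃] [TopologicalSpace M₃] [DiscreteTopology M₃]
  {ρ₁ : DiscreteGaloisModule F M₁} {ρ₂ : DiscreteGaloisModule F M₂} {ρ₃ : DiscreteGaloisModule F M₃}
  {ι : ρ₁.toContRepresentation →ⁱL ρ₂.toContRepresentation}
  {π : ρ₂.toContRepresentation →ⁱL ρ₃.toContRepresentation}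

/-- `#G = #ker f · #range f` for an additive homomorphism out of a finite group. [folklore] -/
theorem natCard_eq_card_ker_mul_card_range {G H : Type*} [AddCommGroup G] [AddGroup H] [Finite G]
    (f : G →+ H) : Nat.card G = Nat.card f.ker * Nat.card f.range := by
  rw [mul_comm, ← Nat.card_congr (QuotientAddGroup.quotientKerEquivRange f).toEquiv]
  exact AddSubgroup.card_eq_card_quotient_mul_card_addSubgroup f.ker

/-- **`H²(ι) = 0` by counting.**  For `0 → M₁ —ι→ M₂ —π→ M₃ → 0` exact (discrete Galois modules over
a field `F`) with finite cohomology of sizes `#H¹(F, Mᵢ) = h²` (`i = 1, 2, 3`),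
`#M₃^{Γ_F} = h = #H²(F, M₁)`, and `π` killing `M₂^{Γ_F}`: the connecting map
`δ₁ : H¹(F, M₃) → H²(F, M₁)` is onto, so `H²(ι) : H²(F, M₁) → H²(F, M₂)` vanishes.  (Exactness at
`M₃^Γ`, `H¹(M₁)`, `H¹(M₂)`, `H¹(M₃)`, `H²(M₁)` of the long exact sequence; `#range δ₀ = h`,
`#range H¹(ι) = h`, `#range H¹(π) = h`, `#range δ₁ = h`.) [cite: SerreGaloisCohomology1997, I §2.2]
[cite: JetchevSkinnerWan2017, §2.2.2 (arXiv:1512.06894 p. 6)] -/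
theorem IsSES.map_two_eq_zero_of_card
    (hses : IsSES (DiscreteGaloisModule.homOfIntertwining ι) (DiscreteGaloisModule.homOfIntertwining π))
    [Finite (galoisCohomology ρ₁ 1)] [Finite (galoisCohomology ρ₂ 1)] [Finite (galoisCohomology ρ₃ 1)]
    [Finite (galoisCohomology ρ₁ 2)] [Finite ρ₃.toTopRep.ρ.invariants] {h : ℕ} (hh : h ≠ 0)
    (h1 : Nat.card (galoisCohomology ρ₁ 1) = h * h) (h2 : Nat.card (galoisCohomology ρ₂ 1) = h * h)
    (h3 : Nat.card (galoisCohomology ρ₃ 1) = h * h)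
    (h0 : Nat.card ρ₃.toTopRep.ρ.invariants = h) (h4 : Nat.card (galoisCohomology ρ₁ 2) = h)
    (hπ : ∀ w ∈ ρ₂.toTopRep.ρ.invariants, π w = 0)
    (z : galoisCohomology ρ₁ 2) : galoisCohomology.map ι 2 z = 0 := by
  -- the four maps as additive homomorphisms
  let d0 : ρ₃.toTopRep.ρ.invariants →+ galoisCohomology ρ₁ 1 := hses.δ₀.toAddMonoidHom
  let i1 : galoisCohomology ρ₁ 1 →+ galoisCohomology ρ₂ 1 := galoisCohomology.map ι 1
  let p1 : galoisCohomology ρ₂ 1 →+ galoisCohomology ρ₃ 1 := galoisCohomology.map π 1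
  let d1 : galoisCohomology ρ₃ 1 →+ galoisCohomology ρ₁ 2 := hses.δ₁.toAddMonoidHom
  -- (a) `δ₀` is injective: its kernel consists of the images of `M₂^Γ`, killed by `π`
  have hker0 : d0.ker = ⊥ := by
    rw [eq_bot_iff]
    intro v hv
    rw [AddMonoidHom.mem_ker] at hv
    obtain ⟨w, hw, hwv⟩ := (hses.δ₀_eq_zero_iff v).mp hv
    rw [AddSubgroup.mem_bot]
    apply Subtype.ext
    rw [← hwv]
    exact hπ w hw
  have hr0 : Nat.card d0.range = h := by
    have e := natCard_eq_card_ker_mul_card_range d0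
    rw [hker0, AddSubgroup.card_bot, one_mul, h0] at e
    exact e.symm
  -- (b) `range δ₀ = ker H¹(ι)`
  have hk1 : i1.ker = d0.range := by
    ext x
    rw [AddMonoidHom.mem_ker, AddMonoidHom.mem_range]
    constructor
    · intro hx
      obtain ⟨v, hv⟩ := hses.exists_δ₀_eq_of_map_one_eq_zero x hx
      exact ⟨v, hv⟩
    · rintro ⟨v, rfl⟩
      exact hses.map_one_δ₀ v
  have hr1 : Nat.card i1.range = h := by
    have e := natCard_eq_card_ker_mul_card_range i1
    rw [hk1, hr0, h1] at e
    exact (Nat.eq_of_mul_eq_mul_left (Nat.pos_of_ne_zero hh) e.symm)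
  -- (c) `range H¹(ι) = ker H¹(π)`
  have hk2 : p1.ker = i1.range := by
    ext y
    rw [AddMonoidHom.mem_ker, AddMonoidHom.mem_range]
    constructor
    · intro hy
      obtain ⟨x, hx⟩ := hses.exists_map_one_eq_of_map_one_eq_zero y hy
      exact ⟨x, hx⟩
    · rintro ⟨x, rfl⟩
      obtain ⟨φ, rfl⟩ := oneCocycleClass_surjective _ x
      change galoisCohomology.map π 1 (galoisCohomology.map ι 1 (oneCocycleClass _ φ)) = 0
      rw [galoisCohomology.map_one_oneCocycleClass, galoisCohomology.map_one_oneCocycleClass]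
      refine (oneCocycleClass_eq_zero_iff _ _).mpr ⟨0, fun σ ↦ ?_⟩
      rw [map_zero, sub_zero]
      exact hses.g_f_apply (φ.1 σ)
  have hr2 : Nat.card p1.range = h := by
    have e := natCard_eq_card_ker_mul_card_range p1
    rw [hk2, hr1, h2] at e
    exact (Nat.eq_of_mul_eq_mul_left (Nat.pos_of_ne_zero hh) e.symm)
  -- (d) `range H¹(π) = ker δ₁`
  have hk3 : d1.ker = p1.range := by
    ext x
    rw [AddMonoidHom.mem_ker, AddMonoidHom.mem_range]
    constructor
    · intro hx
      obtain ⟨y, hy⟩ := hses.exists_map_one_eq_of_δ₁_eq_zero x hx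
      exact ⟨y, hy⟩
    · rintro ⟨y, rfl⟩
      exact hses.δ₁_map_one y
  have hr3 : Nat.card d1.range = h := by
    have e := natCard_eq_card_ker_mul_card_range d1
    rw [hk3, hr2, h3] at e
    exact (Nat.eq_of_mul_eq_mul_left (Nat.pos_of_ne_zero hh) e.symm)
  -- (e) `δ₁` is onto `H²(M₁)`; `H²(ι) ∘ δ₁ = 0`
  have htop : d1.range = ⊤ := AddSubgroup.eq_top_of_card_eq _ (by rw [hr3, h4])
  have hz : z ∈ d1.range := htop ▸ AddSubgroup.mem_top z
  obtain ⟨x, rfl⟩ := hz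
  exact hses.map_two_δ₁ x

end Counting

/-! ## §2. The transition map `H²(K_v, E[p^a]) → H²(K_v, E[p^a p^b])` vanishes for large `a, b` -/

section Curve

-- `H²` needs `LocallyCompactSpace Γ`; compactness of absolute Galois groups, locally.
attribute [local instance] absoluteGaloisGroup_compactSpace finite_geomTorsion_of_neZero

variable {K : Type u} [Field K] [NumberField K] (W : WeierstrassCurve K) [W.IsElliptic] (p : ℕ)
  [Fact p.Prime] (v : HeightOneSpectrum (𝓞 K))

/-- A bound `e` with `p^e · Q = 0` for EVERY `K_v`-rational point `Q` of `p`-power order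
(`#E(K_v)[p^j] ≤ B_v` uniformly, `LocalPrimaryFinite`; a point of order `p^t` spans `p^t ≤ B_v`
points, so `t ≤ B_v`). [cite: GreenbergLNM1716, §3 Lemma 3.3 (p. 87)] -/
theorem exists_pow_nsmul_rational_eq_zero (hpv : (p : 𝓞 K) ∉ v.asIdeal) :
    ∃ e : ℕ, ∀ (j : ℕ) (Q : (W.baseChange (v.adicCompletion K)).toAffine.Point),
      p ^ j • Q = 0 → p ^ e • Q = 0 := by
  haveI : CharZero (v.adicCompletion K) :=
    charZero_of_injective_algebraMap (algebraMap K (v.adicCompletion K)).injective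
  set B := Nat.card {Q : W.geomPrimaryTorsion p | ∀ σ : absoluteGaloisGroup (v.adicCompletion K),
    GaloisRep.restrictField (v.adicCompletion K) (LocBridge.primaryGaloisModule W p) σ Q = Q} with hB
  refine ⟨B, fun j Q hQ ↦ ?_⟩
  -- the cyclic group spanned by `Q` inside `E(K_v)[p^j]` has order `addOrderOf Q = p^t ≤ B`
  have hfin : Finite (nsmulAddMonoidHom (p ^ j) :
      (W.baseChange (v.adicCompletion K)).toAffine.Point →+ _).ker := by
    haveI : NeZero (p ^ j) := ⟨pow_ne_zero j (Fact.out : p.Prime).ne_zero⟩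
    haveI : Finite (W.geomTorsion ((p ^ j : ℕ) : ℤ)) := finite_geomTorsion_of_neZero W (p ^ j)
    refine Nat.finite_of_card_ne_zero ?_
    rw [← natCard_invariants_torsion_restrictField W (v.adicCompletion K)
      (pow_ne_zero j (Fact.out : p.Prime).ne_zero)]
    haveI : Finite (GaloisRep.restrictField (v.adicCompletion K)
        (W.torsionGaloisModule ((p ^ j : ℕ) : ℤ))).toTopRep.ρ.invariants := by
      exact Finite.of_injective (fun x : (GaloisRep.restrictField (v.adicCompletion K)
        (W.torsionGaloisModule ((p ^ j : ℕ) : ℤ))).toTopRep.ρ.invariants ↦ (x.1 : W.geomTorsion _))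
        (fun a b hab ↦ Subtype.ext hab)
    exact Nat.card_pos.ne'
  have hcard : Nat.card (nsmulAddMonoidHom (p ^ j) :
      (W.baseChange (v.adicCompletion K)).toAffine.Point →+ _).ker ≤ B := by
    rw [← natCard_invariants_torsion_restrictField W (v.adicCompletion K)
      (pow_ne_zero j (Fact.out : p.Prime).ne_zero)]
    exact LocBridge.natCard_invariants_torsion_le W p v hpv j
  haveI := hfin
  have hQmem : Q ∈ (nsmulAddMonoidHom (p ^ j) :
      (W.baseChange (v.adicCompletion K)).toAffine.Point →+ _).ker := by
    rw [AddMonoidHom.mem_ker, nsmulAddMonoidHom_apply]; exact hQ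
  -- `addOrderOf Q ∣ p^j`, and `addOrderOf Q ≤ B`
  have hord : addOrderOf Q ∣ p ^ j := addOrderOf_dvd_of_nsmul_eq_zero hQ
  obtain ⟨t, -, ht⟩ := (Nat.dvd_prime_pow (Fact.out : p.Prime)).mp hord
  have hle : addOrderOf Q ≤ B := by
    have h1 : Nat.card (AddSubgroup.zmultiples Q) ≤ Nat.card (nsmulAddMonoidHom (p ^ j) :
        (W.baseChange (v.adicCompletion K)).toAffine.Point →+ _).ker :=
      Nat.card_le_card_of_injective (AddSubgroup.inclusion
        (AddSubgroup.zmultiples_le.mpr hQmem)) (AddSubgroup.inclusion_injective _)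
    rw [Nat.card_zmultiples] at h1
    exact h1.trans hcard
  have htB : t ≤ B := by
    rw [ht] at hle
    exact (Nat.lt_pow_self (Fact.out : p.Prime).one_lt).le.trans hle
  rw [← pow_mul_pow_sub p htB, mul_comm, mul_smul, ← ht, addOrderOf_nsmul_eq_zero, smul_zero]

/-- A uniform exponent for the `Γ_{K_v}`-fixed part of `E[p^∞](K̄)` (`v ∤ p`): `p^e · Q = 0` for
every `Q ∈ E[p^∞](K̄)^{Γ_{K_v}}` (the fixed set is finite, `LocalPrimaryFinite`; the cyclic group
spanned by `Q` lies in it). [cite: GreenbergLNM1716, §3 Lemma 3.3 (p. 87)] -/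
theorem exists_pow_nsmul_fixed_eq_zero (hpv : (p : 𝓞 K) ∉ v.asIdeal) :
    ∃ e : ℕ, ∀ Q : W.geomPrimaryTorsion p,
      (∀ σ : absoluteGaloisGroup (v.adicCompletion K),
        GaloisRep.restrictField (v.adicCompletion K) (LocBridge.primaryGaloisModule W p) σ Q = Q) →
      p ^ e • Q = 0 := by
  set Fx := {Q : W.geomPrimaryTorsion p | ∀ σ : absoluteGaloisGroup (v.adicCompletion K),
    GaloisRep.restrictField (v.adicCompletion K) (LocBridge.primaryGaloisModule W p) σ Q = Q} with hFx
  haveI : Finite Fx := (LocBridge.finite_setOf_fixed_geomPrimaryTorsion W p v hpv).to_subtype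
  refine ⟨Nat.card Fx, fun Q hQ ↦ ?_⟩
  -- the fixed points form a subgroup containing `zmultiples Q`
  let Fsub : AddSubgroup (W.geomPrimaryTorsion p) :=
    { carrier := Fx
      zero_mem' := fun σ ↦ map_zero _
      add_mem' := fun {a b} ha hb σ ↦ by rw [map_add, ha σ, hb σ]
      neg_mem' := fun {a} ha σ ↦ by rw [map_neg, ha σ] }
  have hsub : AddSubgroup.zmultiples Q ≤ Fsub := AddSubgroup.zmultiples_le.mpr hQ
  have hle : addOrderOf Q ≤ Nat.card Fx := by
    have h1 := Nat.card_le_card_of_injective (AddSubgroup.inclusion hsub)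
      (AddSubgroup.inclusion_injective hsub)
    rwa [Nat.card_zmultiples] at h1
  obtain ⟨k, hk⟩ := AddCommGroup.mem_primaryComponent.mp Q.2
  have hkQ : p ^ k • Q = 0 := Subtype.ext (by rw [AddSubmonoidClass.coe_nsmul, hk, ZeroMemClass.coe_zero])
  obtain ⟨t, -, ht⟩ := (Nat.dvd_prime_pow (Fact.out : p.Prime)).mp (addOrderOf_dvd_of_nsmul_eq_zero hkQ)
  have htB : t ≤ Nat.card Fx := by
    rw [ht] at hle
    exact (Nat.lt_pow_self (Fact.out : p.Prime).one_lt).le.trans hle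
  rw [← pow_mul_pow_sub p htB, mul_comm, mul_smul, ← ht, addOrderOf_nsmul_eq_zero, smul_zero]

/-- **The transition map `H²(K_v, E[p^a]) → H²(K_v, E[p^a · p^b])` is ZERO for `a, b` large** (at
a finite place `v ∤ p`; precisely: whenever `p^a` and `p^b` kill the `K_v`-rational and the
`Γ_{K_v}`-fixed geometric `p`-power torsion), GIVEN Milne I 2.8 at `K_v` (`hEP`, cited): the
counting lemma `IsSES.map_two_eq_zero_of_card` for `0 → E[p^a] → E[p^a p^b] → E[p^b] → 0`
(`torsion_isSES`), with `#H¹(K_v, E[n]) = #E(K_v)[n]²`, `#H²(K_v, E[n]) = #E(K_v)[n]`,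
`#H⁰ = #E(K_v)[n]` (tree `LocalEulerCharacteristicTorsion`) and `#E(K_v)[n] = h` for all three
levels.  The finite-level content of "`H²(K_v, E[p^∞]) = 0` (dual to `H⁰(K_v, T_p E) = 0`)" (JSW17
§2.2.2, Lemma 3.3.3). [cite: JetchevSkinnerWan2017, §2.2.2 and Lemma 3.3.3 (arXiv:1512.06894 pp. 6, 12)]
[cite: MilneADT2006, Ch. I §2, Thm. 2.8 and Cor. 2.3] -/
theorem map_two_torsionInclusion_eq_zero
    (hEP : localEulerPoincareCharacteristic (v.adicCompletion K)) (hpv : (p : 𝓞 K) ∉ v.asIdeal)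
    {e : ℕ}
    (he : ∀ (j : ℕ) (Q : (W.baseChange (v.adicCompletion K)).toAffine.Point),
      p ^ j • Q = 0 → p ^ e • Q = 0)
    (he' : ∀ Q : W.geomPrimaryTorsion p,
      (∀ σ : absoluteGaloisGroup (v.adicCompletion K),
        GaloisRep.restrictField (v.adicCompletion K) (LocBridge.primaryGaloisModule W p) σ Q = Q) →
      p ^ e • Q = 0)
    {a b : ℕ} (ha0 : a ≠ 0) (hb0 : b ≠ 0) (ha : e ≤ a) (hb : e ≤ b)
    (z : galoisCohomology (GaloisRep.restrictField (v.adicCompletion K)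
      (W.torsionGaloisModule ((p ^ a : ℕ) : ℤ))) 2) :
    galoisCohomology.map ((W.torsionInclusion
      (Dvd.intro ((p ^ b : ℕ) : ℤ) rfl : ((p ^ a : ℕ) : ℤ) ∣ ((p ^ a : ℕ) : ℤ) * ((p ^ b : ℕ) : ℤ))).restrictField
        (v.adicCompletion K)) 2 z = 0 := by
  have hprime : p.Prime := Fact.out
  haveI : CharZero (v.adicCompletion K) :=
    charZero_of_injective_algebraMap (algebraMap K (v.adicCompletion K)).injective
  have hka : ((p ^ a : ℕ) : ℤ) ≠ 0 := by exact_mod_cast pow_ne_zero a hprime.ne_zero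
  have hses := (W.torsion_isSES hka ((p ^ b : ℕ) : ℤ)).restrictField (v.adicCompletion K)
  -- sizes of the rational `p^j`-torsion: all equal to `h := #E(K_v)[p^e]` for `j ≥ e`
  set F := v.adicCompletion K with hF
  have hker : ∀ {j : ℕ}, e ≤ j →
      (nsmulAddMonoidHom (p ^ j) : (W.baseChange F).toAffine.Point →+ _).ker =
        (nsmulAddMonoidHom (p ^ e) : (W.baseChange F).toAffine.Point →+ _).ker := by
    intro j hj
    ext Q
    simp only [AddMonoidHom.mem_ker, nsmulAddMonoidHom_apply]
    constructor
    · exact he j Q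
    · intro hQ
      rw [← pow_mul_pow_sub p hj, mul_comm, mul_smul, hQ, smul_zero]
  set h := Nat.card (nsmulAddMonoidHom (p ^ e) : (W.baseChange F).toAffine.Point →+ _).ker with hh
  -- `h ≠ 0` and finiteness of the invariants
  haveI hfinT : ∀ n : ℕ, [NeZero n] → Finite (W.geomTorsion (n : ℤ)) := fun n _ ↦
    finite_geomTorsion_of_neZero W n
  have hinvfin : ∀ (n : ℕ) [NeZero n],
      Finite (GaloisRep.restrictField F (W.torsionGaloisModule (n : ℤ))).toTopRep.ρ.invariants :=
    fun n _ ↦ Finite.of_injective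
      (fun x : (GaloisRep.restrictField F (W.torsionGaloisModule (n : ℤ))).toTopRep.ρ.invariants ↦
        (x.1 : W.geomTorsion (n : ℤ))) (fun x y hxy ↦ Subtype.ext hxy)
  haveI : NeZero (p ^ a) := ⟨pow_ne_zero a hprime.ne_zero⟩
  haveI : NeZero (p ^ b) := ⟨pow_ne_zero b hprime.ne_zero⟩
  haveI : NeZero (p ^ a * p ^ b) := ⟨mul_ne_zero (pow_ne_zero a hprime.ne_zero) (pow_ne_zero b hprime.ne_zero)⟩
  have hab : p ^ a * p ^ b = p ^ (a + b) := (pow_add p a b).symm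
  have hppa : IsPrimePow (p ^ a) := hprime.isPrimePow.pow ha0
  have hppb : IsPrimePow (p ^ b) := hprime.isPrimePow.pow hb0
  have hppab : IsPrimePow (p ^ a * p ^ b) := by
    rw [hab]; exact hprime.isPrimePow.pow (by omega)
  have hh0 : h ≠ 0 := by
    haveI := hinvfin (p ^ e)
    rw [hh, ← natCard_invariants_torsion_restrictField W F (pow_ne_zero e hprime.ne_zero)]
    haveI : NeZero (p ^ e) := ⟨pow_ne_zero e hprime.ne_zero⟩
    exact Nat.card_pos.ne'
  -- the five counts
  have hq : ∀ j : ℕ, Nat.card (v.adicCompletionIntegers K ⧸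
      Ideal.span {((p ^ j : ℕ) : v.adicCompletionIntegers K)}) = 1 :=
    LocBridge.natCard_quotient_span_pow_eq_one p v hpv
  have hH1 : ∀ {j : ℕ} [NeZero (p ^ j)], IsPrimePow (p ^ j) → e ≤ j →
      Nat.card (galoisCohomology (GaloisRep.restrictField F
        (W.torsionGaloisModule ((p ^ j : ℕ) : ℤ))) 1) = h * h := by
    intro j _ hpp hj
    rw [natCard_galoisCohomology_one_torsion_adicCompletion_eq_sq W v (p ^ j) hpp hEP, hq j, mul_one,
      hker hj, sq]
  have h1 := hH1 hppa ha
  have h3 := hH1 hppb hb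
  have h2 : Nat.card (galoisCohomology (GaloisRep.restrictField F
      (W.torsionGaloisModule (((p ^ a : ℕ) : ℤ) * ((p ^ b : ℕ) : ℤ)))) 1) = h * h := by
    have h2' := natCard_galoisCohomology_one_torsion_adicCompletion_eq_sq W v (p ^ a * p ^ b) hppab hEP
    rw [Nat.cast_mul] at h2'
    have hq' : Nat.card (v.adicCompletionIntegers K ⧸
        Ideal.span {((p ^ a * p ^ b : ℕ) : v.adicCompletionIntegers K)}) = 1 := by
      rw [hab]; exact hq (a + b)
    rw [h2', hq', mul_one, sq]
    have hk : (nsmulAddMonoidHom (p ^ a * p ^ b) : (W.baseChange F).toAffine.Point →+ _).ker =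
        (nsmulAddMonoidHom (p ^ e) : (W.baseChange F).toAffine.Point →+ _).ker := by
      rw [hab]; exact hker (by omega)
    rw [hk]
  have h0 : Nat.card (GaloisRep.restrictField F
      (W.torsionGaloisModule ((p ^ b : ℕ) : ℤ))).toTopRep.ρ.invariants = h := by
    rw [natCard_invariants_torsion_restrictField W F (pow_ne_zero b hprime.ne_zero), hker hb]
  have h4 : Nat.card (galoisCohomology (GaloisRep.restrictField F
      (W.torsionGaloisModule ((p ^ a : ℕ) : ℤ))) 2) = h := by
    rw [(natCard_galoisCohomology_two_torsion_restrictField W F (p ^ a) hppa).2, hker ha]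
  -- finiteness instances
  haveI := (natCard_galoisCohomology_two_torsion_restrictField W F (p ^ a) hppa).1
  haveI := (localEulerPoincareCharacteristic_adicCompletion K v hEP
    (GaloisRep.restrictField F (W.torsionGaloisModule ((p ^ a : ℕ) : ℤ)))).1
  haveI := (localEulerPoincareCharacteristic_adicCompletion K v hEP
    (GaloisRep.restrictField F (W.torsionGaloisModule ((p ^ b : ℕ) : ℤ)))).1
  haveI : Finite (W.geomTorsion (((p ^ a : ℕ) : ℤ) * ((p ^ b : ℕ) : ℤ))) := by
    rw [← Nat.cast_mul]; exact finite_geomTorsion_of_neZero W (p ^ a * p ^ b)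
  haveI := (localEulerPoincareCharacteristic_adicCompletion K v hEP
    (GaloisRep.restrictField F (W.torsionGaloisModule (((p ^ a : ℕ) : ℤ) * ((p ^ b : ℕ) : ℤ))))).1
  haveI := hinvfin (p ^ b)
  -- `π = [p^a]` kills the invariants of the middle term
  have hπ : ∀ w ∈ (GaloisRep.restrictField F
      (W.torsionGaloisModule (((p ^ a : ℕ) : ℤ) * ((p ^ b : ℕ) : ℤ)))).toTopRep.ρ.invariants,
      (W.torsionMulBy ((p ^ a : ℕ) : ℤ) ((p ^ b : ℕ) : ℤ)).restrictField F w = 0 := by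
    intro w hw
    -- `w` as a fixed point of `E[p^∞]`
    have hwmem : (w : W.geomPoints) ∈ W.geomPrimaryTorsion p :=
      AddCommGroup.mem_primaryComponent.mpr ⟨a + b, by
        rw [← hab, ← natCast_zsmul, Nat.cast_mul]; exact (W.mem_geomTorsion_iff _ _).mp w.2⟩
    have hfix := he' ⟨(w : W.geomPoints), hwmem⟩ fun σ ↦ Subtype.ext
      (congrArg Subtype.val ((Representation.mem_invariants _ w).mp hw σ) :)
    have hcoe : p ^ e • (w : W.geomPoints) = 0 := by
      have := congrArg Subtype.val hfix
      simpa only [AddSubmonoidClass.coe_nsmul, ZeroMemClass.coe_zero] using this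
    have key : ∀ P : W.geomPoints, p ^ e • P = 0 → ((p ^ a : ℕ) : ℤ) • P = 0 := fun P hP ↦ by
      rw [natCast_zsmul, ← pow_mul_pow_sub p ha, mul_comm, mul_smul, hP, smul_zero]
    apply Subtype.ext
    rw [ContIntertwiningMap.restrictField_apply, WeierstrassCurve.coe_torsionMulBy_apply,
      ZeroMemClass.coe_zero]
    exact key _ hcoe
  exact IsSES.map_two_eq_zero_of_card hses hh0 h1 h2 h3 h0 h4 hπ z

/-- **Existential form**: at a finite place `v ∤ p` there is a level `e` beyond which ALL the
transition maps `H²(K_v, E[p^a]) → H²(K_v, E[p^a · p^b])` (`a, b ≥ e`, `a, b ≥ 1`) vanish — the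
direct system `(H²(K_v, E[p^k]))_k` is essentially zero, i.e. `H²(K_v, E[p^∞]) = 0` at finite level
(GIVEN Milne I 2.8 at `K_v`). [cite: JetchevSkinnerWan2017, §2.2.2 and Lemma 3.3.3 (arXiv:1512.06894 pp. 6, 12)]
[cite: GreenbergLNM1716, §3 Lemma 3.3 (p. 87)] -/
theorem exists_forall_map_two_torsionInclusion_eq_zero
    (hEP : localEulerPoincareCharacteristic (v.adicCompletion K)) (hpv : (p : 𝓞 K) ∉ v.asIdeal) :
    ∃ e : ℕ, ∀ (a b : ℕ), a ≠ 0 → b ≠ 0 → e ≤ a → e ≤ b →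
      ∀ z : galoisCohomology (GaloisRep.restrictField (v.adicCompletion K)
        (W.torsionGaloisModule ((p ^ a : ℕ) : ℤ))) 2,
      galoisCohomology.map ((W.torsionInclusion
        (Dvd.intro ((p ^ b : ℕ) : ℤ) rfl :
          ((p ^ a : ℕ) : ℤ) ∣ ((p ^ a : ℕ) : ℤ) * ((p ^ b : ℕ) : ℤ))).restrictField
          (v.adicCompletion K)) 2 z = 0 := by
  obtain ⟨e₁, he₁⟩ := exists_pow_nsmul_rational_eq_zero W p v hpv
  obtain ⟨e₂, he₂⟩ := exists_pow_nsmul_fixed_eq_zero W p v hpv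
  refine ⟨e₁ + e₂, fun a b ha0 hb0 ha hb z ↦
    map_two_torsionInclusion_eq_zero W p v hEP hpv (e := e₁ + e₂) ?_ ?_ ha0 hb0 ha hb z⟩
  · intro j Q hQ
    rw [pow_add, mul_comm, mul_smul, he₁ j Q hQ, smul_zero]
  · intro Q hQ
    rw [pow_add, mul_smul, he₂ Q hQ, smul_zero]

end Curve

end Summit.BirchSwinnertonDyer.Rank1Residual.X11b.Levels

end
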